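import Literature.MathematicalPhysics.QuantumFieldTheory.Balaban1983to89.B16Ineq19BoxChart
import Literature.MathematicalPhysics.QuantumFieldTheory.Balaban1983to89.B5Bounds167Lattice
import Literature.MathematicalPhysics.QuantumFieldTheory.Balaban1983to89.B5Action121

/-!
# `Balaban1983to89.B16Ineq17BoxTorus` — T. Bałaban, *Large field renormalization. II. Localization, exponentiation, and bounds for the 𝐑 operation*, Commun. Math. Phys. **122** (1989) 355–392 [Balaban1989LargeFieldII], (1.7)/(1.9) p. 358: the BOX ↔ TORUS carrier knit — the box-chart field `B′` of the (1.2) integral (bonds of the parallelepiped `Λ` off the comb tree `G₀`) zero-extended to *"the whole lattice"* (the unit torus of [Balaban1984PropagatorsI]), so that (1.7) on the box chart is FED by r02's kernel proof of (1.67) [10] with the explicit `γ₀ = (4/π²)^{d+2}`, and (1.9) follows on the chart modulo the ONE printed perturbation letter of p. 357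

statement-level skeleton of published theorems with citation tags; proofs where landed; nothing here is a claim about the Yang–Mills mass gap

PDF held: `paper:balaban1989-cmp122-large-field-ii` (journal page = PDF page + 354; pp. 357–358 = PDF 3–4; the x2 renders
`run/shared/lean/pub/pub-balaban/b2b-balaban-ref1/pages/1989-cmp122-large-field-II/…-p003-x2.png`, `…-p004-x2.png` were read as
images by r13 and by this seat's earlier generations); `paper:balaban1984-cmp95-propagators-rt-i` p. 29 = PDF 13 ((1.65)–(1.67),
typed and PROVED on the unit torus by r02 in `B5Bounds167Lattice`).

THE PRINT (p. 357 foot – p. 358 [PDF 3–4], verbatim, the sentences this file serves): *«The leading term in the expansion is the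
quadratic form with the background field identically equal to 1.  Replacing the minimizer in this form by the kᵗʰ minimizer
defined on the whole lattice, and the function ζ₀ by the function identically equal to 1, we change the form by a quadratic
form bounded by O(exp(−R_k)).  Now the leading quadratic form is equal to ⟨B′, Δ_kB′⟩ defined by (1.65), (1.66) [10].  Using the
bound (1.67) [10] for this form, we obtain ⟨H_{1,k}B′, Δ₁(ζ₀)H_{1,k}B′⟩ ≧ γ₀‖∂B′‖² − O(1)(M⁶R_kε_k + exp(−R_k))‖B′‖². (1.7) …
The inequalities (1.7), (1.8) imply finally ⟨H_{1,k}B′, Δ₁(ζ₀)H_{1,k}B′⟩ ≧ γ₀/(2d(100M)⁵)‖B′‖², (1.9) for g_k sufficiently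
small.»*  Here `B′` is a field on the bonds of `Λ` with `B′ = 0` on `G₀` ((1.2), (1.8)), while `⟨B′, Δ_kB′⟩` of [10] is a form
on fields on the WHOLE (periodic) lattice: print silently reads `B′` as a field on the whole lattice, zero off `Λ`.

WHAT IS REPRODUCED (mega-formalization `lit-balaban`, HOME `run/shared/lean/pub/lit-balaban/`, Phase-2 seat p26, generation 10;
SKELETON rows **B16.Eq1.7** / **B16.Eq1.9** (owner r13; decls of record `B16Sect1Wilson.Ineq17` / `Ineq19`, typed p238829); the
item *«knit the (1.8)/(1.9) BOX carrier (`B16Eq18Proof`/`B16Ineq19BoxChart`) to B5's unit-TORUS form carrier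
(`B5Bounds167Lattice`) so that `ineq19_chart_of_17`'s hypothesis h17 is fed by `ineq17_lattice` modulo the two letters»* of
r13's `SURVEY-B16-remaining.md` §B 1.7, offered to successors at r13 gen 13's close; referee ref-5).  KNITTING only: the
typed statements and their proofs are r13's (`B16Sect1Wilson`, `B16Ineq17Assembly` p308115), r02's (`B5Bounds167Lattice`,
(1.67) with `γ₀ = (4/π²)^{d+2}`), p30/r13's (`B16Eq18Proof` (1.8) on the box, `B16Ineq19BoxChart` the chart) — consumed BY
NAME, nothing re-proved.
  §1 `toTor Mt y` — the site map `ℤ^d → T = Π_μ ℤ/Mt_μ`, `x ↦ (x − y) mod Mt` (lower corner `y` of `Λ = box n y` to `0`);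
`toTor_add_unitVec` (a lattice step is a torus step), **`toTor_injOn`** (injective on `Λ` as soon as `n_μ ≦ Mt_μ`: *"Λ …
contained in"* the whole lattice).  §2 **`torExt Mt x a`** — the component `a` (orthonormal coordinates of 𝔤, as in
`B16Eq18Proof.ineq18_box_vec`) of the chart field `B16Ineq19BoxChart.ext x` transported to the torus and extended by ZERO
(`torExt_toTor`: on the image of `Λ` it is `B′`; `torExt_of_forall_ne`: zero elsewhere).  §3 **`sum_normSq_torExt`** /
`sum_sum_normSq_torExt_eq_sqN`: `‖B′‖²` is preserved (`Σ_{bonds of T}|B̃′_a|² = Σ_{b∈Λ}B′_a(b)²`, summed over `a` = `‖x‖²`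
= `B16Ineq111Gaussian.sqN x`).  §4 `curl_apply`/`curl_swap`/`curl_self` (r02's `(∂₁B)_{μν}` bond by bond),
**`d1Sq_eq_sum_lt`** (`⟨∂₁B,∂₁B⟩ = Σ_{μ<ν}Σ_x|(∂₁B)_{μν}(x)|²`: the `½Σ_{μ,ν}` of (1.66) over ordered pairs counts each
plaquette once), `curl_torExt_toTor` (on a plaquette of `Λ` the torus curl of the extension IS the box curl
`B6TreeGaugePoincare.curl`), **`boxPlaq_le_d1Sq`** / `boxPlaq_vec_le_sum_d1Sq`: `Σ_{p∈Λ}|(∂B′)(p)|² ≦ ⟨∂₁B̃′, ∂₁B̃′⟩` (the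
plaquettes of `Λ` embed injectively; every other torus plaquette contributes `≥ 0`).  §5 THE KNIT: **`ineq17_chart_lattice`** —
at every chart point `x`, if the form `Q` differs from the leading form of [10] OF THE EXTENDED FIELD,
`Q_k(x) = Σ_a formDk n_k Mt (torExt Mt x a)` (r02's (1.66) third expression, step `n_k = L^k ≧ 1`), by at most
`C(M⁶R_kε_k + e^{−R_k})‖x‖²` (print's two perturbation steps of p. 357 as ONE letter, exactly the `hpert` of r13's
`ineq17_lattice`), then (1.7) holds ON THE BOX CHART: `Ineq17 (Q x) (Σ_{p∈Λ}Σ_a|(∂B′_a)(p)|²) ‖x‖² ((4/π²)^{d+2}) C M R_k ε_k` —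
i.e. the hypothesis `h17` of `B16Ineq19BoxChart.ineq19_chart_of_17` DISCHARGED from (1.67) [10] (r02's `ineq167`, summed over
the components) modulo that letter; **`ineq19_chart_lattice`** — hence (1.9) `Ineq19 (Q x) ‖x‖² ((4/π²)^{d+2}) d M` at every
chart point (sides `n_i ≦ 100M`, *"for g_k sufficiently small"* explicit as in r13's `ineq19_of_17_18`), which is the input
`h19` of `B16Ineq111Gaussian.Inputs.ofPrinted` (rows B16.Lem@358 / B16.Eq1.11) with print's `γ₀` now r02's explicit constant;
`ineq19_chart_leading` — the unperturbed case (`Q` = the leading torus form itself, `C = 0`): (1.9) on the box chart with NO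
hypothesis (non-vacuity of the knit: (1.67) on the torus ∘ (1.8) on the box).

HONEST SCOPE.  (a) The torus `T = Π_μ ℤ/Mt_μ` is ANY with `n_μ ≦ Mt_μ` (print: the whole unit lattice `T₁^{(k)}`, a torus
containing `Λ`; at `Mt = n` the wrap-around bonds are simply not bonds of `Λ` and carry `0`).  (b) NOT discharged, as in
`B16Ineq17Assembly`: the identification of the leading form and the two perturbation bounds of p. 357 (Sect. F [15] / Sect. B
[13] first-order expansion in `A₀`; the `O(e^{−R_k})` replacement) — ONE located hypothesis `hpert`, now stated against a
CONCRETE leading form (`formDk` of the zero-extended chart field) instead of a free real number.  (c) (1.65) = (1.66) is r02's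
declared non-claim (`B5Bounds167Lattice` header (1)); the form here is (1.66)'s third expression, as there.  (d) Lower-corner
box `Λ = box n y` and comb tree `G₀` exactly as `B16Eq18Proof`; `d`, `D = dim 𝔤` arbitrary.  No head change is asked (rows
1.7/1.9 keep their analytic letters; owner r13).  Every declaration is a definition with a body or a proved theorem; no
`sorry`, no new `def … : Prop`; nothing of [10]/[V] is asserted.  Unit `lit-balaban-p26` (literature-prover-lit-balaban-p26-g10-0).
-/

noncomputable section

open scoped BigOperators

namespace Literature.MathematicalPhysics.QuantumFieldTheory.Balaban1983to89.B16Ineq17BoxTorus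

open Finset B16Eq18Proof B16Ineq19BoxChart B16Ineq111Gaussian B16Sect1Wilson
open B6BondElimination (unitVec unitVec_apply add_unitVec_apply)

variable {d : ℕ} {n : Fin d → ℕ} {y : Fin d → ℤ} {D : ℕ}
variable (Mt : Fin d → ℕ)

/-! ## §1  The site map `Λ ⊂ ℤ^d → T = Π_μ ℤ/Mt_μ` -/

/-- The site map of the knit: `x ↦ (x − y) mod Mt`, sending the lowest corner `y` of `Λ = box n y` to `0 ∈ T = Π_μ ℤ/Mt_μ`
(r02's `B5Prop11Plancherel.Tor Mt`) — *"the kᵗʰ minimizer defined on the whole lattice"*: the box is read inside the periodic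
unit lattice. [cite: Balaban1989LargeFieldII, (1.7) p.358] -/
def toTor (y x : Fin d → ℤ) : B5Prop11Plancherel.Tor Mt := fun i => ((x i - y i : ℤ) : ZMod (Mt i))

/-- Coordinates of the site map. [cite: Balaban1989LargeFieldII, (1.7) p.358] -/
theorem toTor_apply (y x : Fin d → ℤ) (i : Fin d) : toTor Mt y x i = ((x i - y i : ℤ) : ZMod (Mt i)) := rfl

/-- A unit step `x ↦ x + e_μ` of `ℤ^d` is the unit step of the torus (`B5Prop11Plancherel.unitVec`). [cite: Balaban1989LargeFieldII, (1.7) p.358] -/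
theorem toTor_add_unitVec (y x : Fin d → ℤ) (μ : Fin d) :
    toTor Mt y (x + unitVec μ) = toTor Mt y x + B5Prop11Plancherel.unitVec Mt μ := by
  funext i
  simp only [toTor_apply, Pi.add_apply, unitVec_apply, B5Prop11Plancherel.unitVec]
  by_cases h : i = μ
  · subst h; rw [if_pos rfl, Pi.single_eq_same]; push_cast; ring
  · rw [if_neg h, Pi.single_eq_of_ne h]; push_cast; ring

/-- **The box embeds**: if every side `n_μ ≦ Mt_μ` (*"Λ … contained in"* the lattice), the site map is injective on `Λ`. [cite: Balaban1989LargeFieldII, (1.8) p.358] -/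
theorem toTor_injOn (hn : ∀ i, n i ≤ Mt i) : Set.InjOn (toTor Mt y) (box n y : Set (Fin d → ℤ)) := by
  intro z hz w hw hzw
  rw [Finset.mem_coe, mem_box] at hz hw
  funext i
  have hi := congr_fun hzw i
  rw [toTor_apply, toTor_apply, ZMod.intCast_eq_intCast_iff'] at hi
  have hz0 : 0 ≤ z i - y i := by linarith [(hz i).1]
  have hw0 : 0 ≤ w i - y i := by linarith [(hw i).1]
  have hzM : z i - y i < (Mt i : ℤ) := by have := (hz i).2; have := hn i; omega
  have hwM : w i - y i < (Mt i : ℤ) := by have := (hw i).2; have := hn i; omega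
  rw [Int.emod_eq_of_lt hz0 hzM, Int.emod_eq_of_lt hw0 hwM] at hi
  linarith

/-! ## §2  The zero extension of the chart field to the torus -/

/-- **The chart field on the whole lattice**: the component `a : Fin D` (orthonormal coordinates of 𝔤) of the box-chart field
`B′ = B16Ineq19BoxChart.ext x` (coordinates `x` on the bonds of `Λ` off `G₀`, zero on `G₀`), placed on the torus bonds
`(toTor z, μ)`, `z ∈ Λ`, and extended by ZERO to all other bonds of `T` — print's reading of `B′` as an argument of
`⟨B′, Δ_kB′⟩` *"defined on the whole lattice"*. [cite: Balaban1989LargeFieldII, (1.7) p.358] -/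
def torExt (x : chartSet n y D → ℝ) (a : Fin D) : B5Prop11Plancherel.Tor Mt × Fin d → ℂ := fun i =>
  ∑ z ∈ box n y, if toTor Mt y z = i.1 then ((ext x (z, i.2) a : ℝ) : ℂ) else 0

/-- On the image of `Λ` the extension is the chart field. [cite: Balaban1989LargeFieldII, (1.7) p.358] -/
theorem torExt_toTor (hn : ∀ i, n i ≤ Mt i) (x : chartSet n y D → ℝ) (a : Fin D) {z : Fin d → ℤ}
    (hz : z ∈ box n y) (μ : Fin d) :
    torExt Mt x a (toTor Mt y z, μ) = ((ext x (z, μ) a : ℝ) : ℂ) := by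
  unfold torExt
  rw [Finset.sum_eq_single_of_mem z hz]
  · rw [if_pos rfl]
  · intro w hw hne
    rw [if_neg]
    exact fun h => hne (toTor_injOn Mt hn (Finset.mem_coe.2 hw) (Finset.mem_coe.2 hz) h)

/-- Off the image of `Λ` the extension vanishes. [cite: Balaban1989LargeFieldII, (1.7) p.358] -/
theorem torExt_of_forall_ne (x : chartSet n y D → ℝ) (a : Fin D) {q : B5Prop11Plancherel.Tor Mt}
    (hq : ∀ z ∈ box n y, toTor Mt y z ≠ q) (μ : Fin d) : torExt Mt x a (q, μ) = 0 :=
  Finset.sum_eq_zero fun z hz => if_neg (hq z hz)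

/-- The chart field vanishes on bonds that are not bonds of `Λ` (the chart lives on `(Λ-bonds ∖ G₀) × Fin D`). [cite: Balaban1989LargeFieldII, (1.2) p.357] -/
theorem ext_eq_zero_of_not_mem_innerBonds (x : chartSet n y D → ℝ) {b : (Fin d → ℤ) × Fin d}
    (hb : b ∉ innerBonds n y) (a : Fin D) : ext x b a = 0 := by
  unfold B16Ineq19BoxChart.ext
  rw [dif_neg]
  exact fun h => hb (mem_chartSet.mp h).1

/-- The bonds of `Λ` start in `Λ`. [cite: Balaban1989LargeFieldII, (1.8) p.358] -/
theorem innerBonds_subset_box_product (n : Fin d → ℕ) (y : Fin d → ℤ) :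
    innerBonds n y ⊆ box n y ×ˢ (univ : Finset (Fin d)) := fun _ hb =>
  Finset.mem_product.2 ⟨(mem_innerBonds.1 hb).1, mem_univ _⟩

/-! ## §3  `‖B′‖²` is preserved -/

variable [hMt : ∀ μ, NeZero (Mt μ)]

/-- **`‖B′‖²` on the torus = `‖B′‖²` on `Λ`**, component by component:
`Σ_{bonds of T}|B̃′_a|² = Σ_{b∈Λ} B′_a(b)²`. [cite: Balaban1989LargeFieldII, (1.7) p.358] -/
theorem sum_normSq_torExt (hn : ∀ i, n i ≤ Mt i) (x : chartSet n y D → ℝ) (a : Fin D) :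
    ∑ i, ‖torExt Mt x a i‖ ^ 2 = ∑ b ∈ innerBonds n y, (ext x b a) ^ 2 := by
  classical
  calc ∑ i, ‖torExt Mt x a i‖ ^ 2
      = ∑ q, ∑ μ, ‖torExt Mt x a (q, μ)‖ ^ 2 := Fintype.sum_prod_type _
    _ = ∑ q ∈ (box n y).image (toTor Mt y), ∑ μ, ‖torExt Mt x a (q, μ)‖ ^ 2 := by
        symm
        refine Finset.sum_subset (Finset.subset_univ _) fun q _ hq => ?_
        refine Finset.sum_eq_zero fun μ _ => ?_
        rw [torExt_of_forall_ne Mt x a (fun z hz h => hq (Finset.mem_image.2 ⟨z, hz, h⟩)) μ, norm_zero]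
        simp
    _ = ∑ z ∈ box n y, ∑ μ, ‖torExt Mt x a (toTor Mt y z, μ)‖ ^ 2 := Finset.sum_image (toTor_injOn Mt hn)
    _ = ∑ z ∈ box n y, ∑ μ, (ext x (z, μ) a) ^ 2 := by
        refine Finset.sum_congr rfl fun z hz => Finset.sum_congr rfl fun μ _ => ?_
        rw [torExt_toTor Mt hn x a hz μ, Complex.norm_real, Real.norm_eq_abs, sq_abs]
    _ = ∑ b ∈ box n y ×ˢ (univ : Finset (Fin d)), (ext x b a) ^ 2 := by
        rw [Finset.sum_product (box n y) univ (fun b => (ext x b a) ^ 2)]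
    _ = ∑ b ∈ innerBonds n y, (ext x b a) ^ 2 := by
        symm
        refine Finset.sum_subset (innerBonds_subset_box_product n y) fun _ _ hb => ?_
        rw [ext_eq_zero_of_not_mem_innerBonds x hb a]
        simp

/-- **`‖B′‖²` preserved, all components**: `Σ_a Σ_{bonds of T}|B̃′_a|² = ‖x‖²` (`B16Ineq111Gaussian.sqN x`, the `‖B′‖²` of the
chart, `B16Ineq19BoxChart.sum_sq_ext_eq_sqN`). [cite: Balaban1989LargeFieldII, (1.7) p.358] -/
theorem sum_sum_normSq_torExt_eq_sqN (hn : ∀ i, n i ≤ Mt i) (x : chartSet n y D → ℝ) :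
    ∑ a, ∑ i, ‖torExt Mt x a i‖ ^ 2 = sqN x := by
  calc ∑ a, ∑ i, ‖torExt Mt x a i‖ ^ 2 = ∑ a, ∑ b ∈ innerBonds n y, (ext x b a) ^ 2 :=
        Finset.sum_congr rfl fun a _ => sum_normSq_torExt Mt hn x a
    _ = ∑ b ∈ innerBonds n y, ∑ a, (ext x b a) ^ 2 := Finset.sum_comm
    _ = sqN x := sum_sq_ext_eq_sqN x

/-! ## §4  `⟨∂₁B̃′, ∂₁B̃′⟩ ≥ Σ_{p∈Λ}|(∂B′)(p)|²` -/

/-- r02's `(∂₁B)_{μν}(x) = B_μ(x) + B_ν(x+e_μ) − B_μ(x+e_ν) − B_ν(x)` bond by bond (the plaquette variable (1.4) of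
[Balaban1984PropagatorsI] at unit spacing). [cite: Balaban1984PropagatorsI, (1.66) p.29] -/
theorem curl_apply (B : B5Prop11Plancherel.Tor Mt × Fin d → ℂ) (μ ν : Fin d) (q : B5Prop11Plancherel.Tor Mt) :
    B5Bounds167Lattice.curl Mt B μ ν q
      = B (q, μ) + B (q + B5Prop11Plancherel.unitVec Mt μ, ν) - B (q + B5Prop11Plancherel.unitVec Mt ν, μ) - B (q, ν) := by
  simp only [B5Bounds167Lattice.curl, B5Prop11Plancherel.fdiff, one_smul, Matrix.sub_mulVec, Matrix.one_mulVec,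
    Pi.sub_apply, B5Action121.shiftM_mulVec]
  ring

/-- Antisymmetry `(∂₁B)_{νμ} = −(∂₁B)_{μν}`. [cite: Balaban1984PropagatorsI, (1.66) p.29] -/
theorem curl_swap (B : B5Prop11Plancherel.Tor Mt × Fin d → ℂ) (μ ν : Fin d) (q : B5Prop11Plancherel.Tor Mt) :
    B5Bounds167Lattice.curl Mt B ν μ q = -B5Bounds167Lattice.curl Mt B μ ν q := by
  rw [curl_apply, curl_apply]; ring

/-- `(∂₁B)_{μμ} = 0`. [cite: Balaban1984PropagatorsI, (1.66) p.29] -/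
theorem curl_self (B : B5Prop11Plancherel.Tor Mt × Fin d → ℂ) (μ : Fin d) (q : B5Prop11Plancherel.Tor Mt) : B5Bounds167Lattice.curl Mt B μ μ q = 0 := by
  rw [curl_apply]; ring

/-- **`⟨∂₁B,∂₁B⟩ = Σ_{μ<ν} Σ_x |(∂₁B)_{μν}(x)|²`**: the `½Σ_{μ,ν}` over ORDERED pairs of (1.66) (r02's `d1Sq`) counts every
plaquette `(x; μ < ν)` exactly once (diagonal terms vanish, the two orders agree). [cite: Balaban1984PropagatorsI, (1.66) p.29] -/
theorem d1Sq_eq_sum_lt (B : B5Prop11Plancherel.Tor Mt × Fin d → ℂ) :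
    B5Bounds167Lattice.d1Sq Mt B
      = ∑ μ, ∑ ν, if μ < ν then ∑ q, ‖B5Bounds167Lattice.curl Mt B μ ν q‖ ^ 2 else 0 := by
  set S : Fin d → Fin d → ℝ := fun μ ν => ∑ q, ‖B5Bounds167Lattice.curl Mt B μ ν q‖ ^ 2 with hS
  have hsymm : ∀ μ ν, S ν μ = S μ ν := by
    intro μ ν
    simp only [hS]
    exact Finset.sum_congr rfl fun q _ => by rw [curl_swap, norm_neg]
  have hdiag : ∀ μ, S μ μ = 0 := by
    intro μ
    simp only [hS]
    exact Finset.sum_eq_zero fun q _ => by rw [curl_self, norm_zero]; simp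
  have hsplit : ∀ μ ν, S μ ν
      = (if μ < ν then S μ ν else 0) + ((if ν < μ then S μ ν else 0) + (if μ = ν then S μ ν else 0)) := by
    intro μ ν
    rcases lt_trichotomy μ ν with h | h | h
    · rw [if_pos h, if_neg (lt_asymm h), if_neg (ne_of_lt h)]; ring
    · subst h; simp
    · rw [if_neg (lt_asymm h), if_pos h, if_neg (ne_of_gt h)]; ring
  have h2 : ∑ μ, ∑ ν, (if ν < μ then S μ ν else 0) = ∑ μ, ∑ ν, (if μ < ν then S μ ν else 0) := by
    rw [Finset.sum_comm]
    exact Finset.sum_congr rfl fun μ _ => Finset.sum_congr rfl fun ν _ => by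
      by_cases h : μ < ν
      · rw [if_pos h, if_pos h, hsymm]
      · rw [if_neg h, if_neg h]
  have h3 : ∑ μ, ∑ ν, (if μ = ν then S μ ν else 0) = 0 := by
    refine Finset.sum_eq_zero fun μ _ => ?_
    rw [Finset.sum_ite_eq]
    simp [hdiag]
  unfold B5Bounds167Lattice.d1Sq
  change 1 / 2 * ∑ μ, ∑ ν, S μ ν = ∑ μ, ∑ ν, if μ < ν then S μ ν else 0
  have htot : ∑ μ, ∑ ν, S μ ν = 2 * ∑ μ, ∑ ν, if μ < ν then S μ ν else 0 := by
    conv_lhs =>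
      arg 2; ext μ; arg 2; ext ν; rw [hsplit μ ν]
    simp only [Finset.sum_add_distrib]
    rw [h2, h3]
    ring
  rw [htot]
  ring

/-- **On a plaquette of `Λ` the torus curl of the extension is the box curl**: for `(z; j < μ)` with its four corners in `Λ`,
`(∂₁B̃′_a)_{jμ}(toTor z) = (∂B′_a)(z; j, μ)` (`B6TreeGaugePoincare.curl`, the plaquette variable of `B16Eq18Proof`). [cite: Balaban1989LargeFieldII, (1.8) p.358] -/
theorem curl_torExt_toTor (hn : ∀ i, n i ≤ Mt i) (x : chartSet n y D → ℝ) (a : Fin D) {z : Fin d → ℤ} {j μ : Fin d}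
    (hp : (z, j, μ) ∈ innerPlaq n y) :
    B5Bounds167Lattice.curl Mt (torExt Mt x a) j μ (toTor Mt y z)
      = ((B6TreeGaugePoincare.curl (fun b => ext x b a) z j μ : ℝ) : ℂ) := by
  obtain ⟨-, hz, hzj, hzμ, -⟩ := mem_innerPlaq_iff.mp hp
  rw [curl_apply, ← toTor_add_unitVec, ← toTor_add_unitVec, torExt_toTor Mt hn x a hz, torExt_toTor Mt hn x a hzj,
    torExt_toTor Mt hn x a hzμ, torExt_toTor Mt hn x a hz, B6TreeGaugePoincare.curl]
  push_cast
  ring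

/-- The plaquettes of `Λ` are among the triples `(z ∈ Λ; j < μ)`. [cite: Balaban1989LargeFieldII, (1.8) p.358] -/
theorem innerPlaq_subset_filter (n : Fin d → ℕ) (y : Fin d → ℤ) :
    innerPlaq n y ⊆ (box n y ×ˢ ((univ : Finset (Fin d)) ×ˢ (univ : Finset (Fin d)))).filter fun p => p.2.1 < p.2.2 := by
  intro p hp
  have h := mem_innerPlaq.1 hp
  exact Finset.mem_filter.2 ⟨Finset.mem_product.2 ⟨h.1, Finset.mem_product.2 ⟨mem_univ _, mem_univ _⟩⟩, h.2.1⟩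

/-- **`Σ_{p∈Λ}|(∂B′_a)(p)|² ≦ ⟨∂₁B̃′_a, ∂₁B̃′_a⟩`**: the plaquettes of `Λ` embed injectively into the plaquettes of the torus
with the same curl; every other torus plaquette (boundary and wrap-around plaquettes, whose missing bonds carry `0`)
contributes a non-negative square. [cite: Balaban1989LargeFieldII, (1.7) p.358] -/
theorem boxPlaq_le_d1Sq (hn : ∀ i, n i ≤ Mt i) (x : chartSet n y D → ℝ) (a : Fin D) :
    ∑ p ∈ innerPlaq n y, B6TreeGaugePoincare.curl (fun b => ext x b a) p.1 p.2.1 p.2.2 ^ 2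
      ≤ B5Bounds167Lattice.d1Sq Mt (torExt Mt x a) := by
  classical
  set G : (Fin d → ℤ) × Fin d × Fin d → ℝ :=
    fun p => ‖B5Bounds167Lattice.curl Mt (torExt Mt x a) p.2.1 p.2.2 (toTor Mt y p.1)‖ ^ 2 with hG
  set H : B5Prop11Plancherel.Tor Mt → ℝ :=
    fun q => ∑ j, ∑ μ, if j < μ then ‖B5Bounds167Lattice.curl Mt (torExt Mt x a) j μ q‖ ^ 2 else 0 with hH
  have hG0 : ∀ p, 0 ≤ G p := fun p => by positivity
  have hH0 : ∀ q, 0 ≤ H q := fun q =>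
    Finset.sum_nonneg fun j _ => Finset.sum_nonneg fun μ _ => by split_ifs <;> positivity
  calc ∑ p ∈ innerPlaq n y, B6TreeGaugePoincare.curl (fun b => ext x b a) p.1 p.2.1 p.2.2 ^ 2
      = ∑ p ∈ innerPlaq n y, G p := by
        refine Finset.sum_congr rfl fun p hp => ?_
        obtain ⟨z, j, μ⟩ := p
        simp only [hG]
        rw [curl_torExt_toTor Mt hn x a hp, Complex.norm_real, Real.norm_eq_abs, sq_abs]
    _ ≤ ∑ p ∈ (box n y ×ˢ ((univ : Finset (Fin d)) ×ˢ (univ : Finset (Fin d)))).filter (fun p => p.2.1 < p.2.2), G p :=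
        Finset.sum_le_sum_of_subset_of_nonneg (innerPlaq_subset_filter n y) fun p _ _ => hG0 p
    _ = ∑ z ∈ box n y, H (toTor Mt y z) := by
        rw [Finset.sum_filter, Finset.sum_product]
        refine Finset.sum_congr rfl fun z _ => ?_
        rw [Finset.sum_product]
    _ = ∑ q ∈ (box n y).image (toTor Mt y), H q := (Finset.sum_image (toTor_injOn Mt hn)).symm
    _ ≤ ∑ q, H q := Finset.sum_le_sum_of_subset_of_nonneg (Finset.subset_univ _) fun q _ _ => hH0 q
    _ = ∑ j, ∑ μ, if j < μ then ∑ q, ‖B5Bounds167Lattice.curl Mt (torExt Mt x a) j μ q‖ ^ 2 else 0 := by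
        simp only [hH]
        rw [Finset.sum_comm]
        refine Finset.sum_congr rfl fun j _ => ?_
        rw [Finset.sum_comm]
        refine Finset.sum_congr rfl fun μ _ => ?_
        by_cases h : j < μ
        · simp only [if_pos h]
        · simp only [if_neg h, Finset.sum_const_zero]
    _ = B5Bounds167Lattice.d1Sq Mt (torExt Mt x a) := (d1Sq_eq_sum_lt Mt _).symm

/-- **All components**: `Σ_{p∈Λ}|(∂B′)(p)|² = Σ_{p∈Λ}Σ_a|(∂B′_a)(p)|² ≦ Σ_a ⟨∂₁B̃′_a, ∂₁B̃′_a⟩` (the `‖∂B′‖²` of (1.7)/(1.8) in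
the orthonormal coordinates of `B16Eq18Proof.ineq18_box_vec`). [cite: Balaban1989LargeFieldII, (1.7) p.358] -/
theorem boxPlaq_vec_le_sum_d1Sq (hn : ∀ i, n i ≤ Mt i) (x : chartSet n y D → ℝ) :
    ∑ p ∈ innerPlaq n y, ∑ a, B6TreeGaugePoincare.curl (fun b => ext x b a) p.1 p.2.1 p.2.2 ^ 2
      ≤ ∑ a, B5Bounds167Lattice.d1Sq Mt (torExt Mt x a) := by
  rw [Finset.sum_comm]
  exact Finset.sum_le_sum fun a _ => boxPlaq_le_d1Sq Mt hn x a

/-! ## §5  The knit: (1.7) and (1.9) on the box chart from (1.67) [10] on the torus -/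

/-- **(1.67) [10] for the extended chart field, summed over the components, read on the box**:
`(4/π²)^{d+2} · Σ_{p∈Λ}|(∂B′)(p)|² ≦ Σ_a ⟨B̃′_a, Δ_kB̃′_a⟩` (r02's `B5Bounds167Lattice.ineq167` BY NAME, step `n_k ≧ 1`). [cite: Balaban1989LargeFieldII, (1.7) p.358] -/
theorem gamma0_boxPlaq_le_formDk (hn : ∀ i, n i ≤ Mt i) (nk : ℕ) [NeZero nk] (hnk : 1 ≤ nk)
    (x : chartSet n y D → ℝ) :
    (4 / Real.pi ^ 2) ^ (d + 2) * ∑ p ∈ innerPlaq n y, ∑ a, B6TreeGaugePoincare.curl (fun b => ext x b a) p.1 p.2.1 p.2.2 ^ 2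
      ≤ ∑ a, B5Bounds167Lattice.formDk nk Mt (torExt Mt x a) := by
  calc (4 / Real.pi ^ 2) ^ (d + 2) * ∑ p ∈ innerPlaq n y, ∑ a, B6TreeGaugePoincare.curl (fun b => ext x b a) p.1 p.2.1 p.2.2 ^ 2
      ≤ (4 / Real.pi ^ 2) ^ (d + 2) * ∑ a, B5Bounds167Lattice.d1Sq Mt (torExt Mt x a) :=
        mul_le_mul_of_nonneg_left (boxPlaq_vec_le_sum_d1Sq Mt hn x) (by positivity)
    _ = ∑ a, (4 / Real.pi ^ 2) ^ (d + 2) * B5Bounds167Lattice.d1Sq Mt (torExt Mt x a) := Finset.mul_sum _ _ _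
    _ ≤ ∑ a, B5Bounds167Lattice.formDk nk Mt (torExt Mt x a) :=
        Finset.sum_le_sum fun a _ => (B5Bounds167Lattice.ineq167 nk Mt hnk (torExt Mt x a)).1

/-- **(1.7) ON THE BOX CHART, fed by the torus (1.67)**: at a chart point `x` of the `B′`-integral (1.2) over
`Λ = box n y ⊂ T` (`n_μ ≦ Mt_μ`), if the quadratic form `Q` differs from the leading form of [10] of the zero-extended field,
`Σ_a ⟨B̃′_a, Δ_kB̃′_a⟩ = Σ_a formDk n_k Mt (torExt Mt x a)` ((1.66), step `n_k = L^k ≧ 1`), by at most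
`C(M⁶R_kε_k + e^{−R_k})‖x‖²` — the two printed perturbation steps of p. 357 as one letter — then
`Ineq17 Q (Σ_{p∈Λ}|(∂B′)(p)|²) ‖x‖² ((4/π²)^{d+2}) C M R_k ε_k`: exactly the hypothesis `h17` of
`B16Ineq19BoxChart.ineq19_chart_of_17`, with r02's explicit `γ₀`. [cite: Balaban1989LargeFieldII, (1.7) p.358] -/
theorem ineq17_chart_lattice (hn : ∀ i, n i ≤ Mt i) (nk : ℕ) [NeZero nk] (hnk : 1 ≤ nk)
    (x : chartSet n y D → ℝ) {Q C M Rk εk : ℝ}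
    (hpert : |Q - ∑ a, B5Bounds167Lattice.formDk nk Mt (torExt Mt x a)|
      ≤ C * (M ^ 6 * Rk * εk + Real.exp (-Rk)) * sqN x) :
    Ineq17 Q (∑ p ∈ innerPlaq n y, ∑ a, B6TreeGaugePoincare.curl (fun b => ext x b a) p.1 p.2.1 p.2.2 ^ 2)
      (sqN x) ((4 / Real.pi ^ 2) ^ (d + 2)) C M Rk εk := by
  -- the three-line bookkeeping of r13's `B16Ineq17Assembly.ineq17_of_pert` (p308115), with `h167` now a theorem
  have h167 := gamma0_boxPlaq_le_formDk Mt hn nk hnk x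
  have h2 := (abs_le.mp hpert).1
  unfold Ineq17
  linarith

/-- **(1.9) ON THE BOX CHART with `h17` DISCHARGED by the torus**: for `Λ = box n y` with sides `n_i ≦ 100M` inside the torus
`T` (`n_i ≦ Mt_i`), `1 ≦ d`, a form `Q` on the chart within the printed perturbation letter of the leading torus form at every
point, and *"g_k sufficiently small"* (`C(M⁶R_kε_k + e^{−R_k}) ≦ γ₀/(2d(100M)^{d+1})`, `γ₀ = (4/π²)^{d+2}`):
`Ineq19 (Q x) ‖x‖² γ₀ d M` at every chart point — the input `h19` of `B16Ineq111Gaussian.Inputs.ofPrinted` — by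
`B16Ineq19BoxChart.ineq19_chart_of_17` ((1.8) on the box, p30/r13) ∘ `ineq17_chart_lattice` ((1.67) on the torus, r02). [cite: Balaban1989LargeFieldII, (1.9) p.358] -/
theorem ineq19_chart_lattice {M : ℕ} (hM : 1 ≤ M) (hn100 : ∀ i, n i ≤ 100 * M) (hd : 1 ≤ d) (hn : ∀ i, n i ≤ Mt i)
    (nk : ℕ) [NeZero nk] (hnk : 1 ≤ nk) (Q : (chartSet n y D → ℝ) → ℝ) {C Rk εk : ℝ}
    (hpert : ∀ x, |Q x - ∑ a, B5Bounds167Lattice.formDk nk Mt (torExt Mt x a)|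
      ≤ C * ((M : ℝ) ^ 6 * Rk * εk + Real.exp (-Rk)) * sqN x)
    (hsmall : C * ((M : ℝ) ^ 6 * Rk * εk + Real.exp (-Rk))
      ≤ (4 / Real.pi ^ 2) ^ (d + 2) / (2 * d * (100 * (M : ℝ)) ^ (d + 1))) :
    ∀ x, Ineq19 (Q x) (sqN x) ((4 / Real.pi ^ 2) ^ (d + 2)) d (M : ℝ) :=
  ineq19_chart_of_17 hM hn100 hd (by positivity) Q (fun x => ineq17_chart_lattice Mt hn nk hnk x (hpert x)) hsmall

/-- **Non-vacuity / the unperturbed case**: for the leading form ITSELF, `Q(x) = Σ_a ⟨B̃′_a, Δ_kB̃′_a⟩` (no perturbation,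
`C = 0`), (1.9) holds on the box chart of every `Λ = box n y ⊂ T` with sides `≦ 100M`:
`γ₀/(2d(100M)^{d+1})·‖x‖² ≦ Σ_a formDk n_k Mt (torExt Mt x a)`, `γ₀ = (4/π²)^{d+2}` — (1.67) on the torus ∘ (1.8) on the box,
hypothesis-free. [cite: Balaban1989LargeFieldII, (1.9) p.358] -/
theorem ineq19_chart_leading {M : ℕ} (hM : 1 ≤ M) (hn100 : ∀ i, n i ≤ 100 * M) (hd : 1 ≤ d) (hn : ∀ i, n i ≤ Mt i)
    (nk : ℕ) [NeZero nk] (hnk : 1 ≤ nk) (x : chartSet n y D → ℝ) :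
    Ineq19 (∑ a, B5Bounds167Lattice.formDk nk Mt (torExt Mt x a)) (sqN x) ((4 / Real.pi ^ 2) ^ (d + 2)) d (M : ℝ) := by
  have h := ineq19_chart_lattice Mt hM hn100 hd hn nk hnk (fun x => ∑ a, B5Bounds167Lattice.formDk nk Mt (torExt Mt x a))
    (C := 0) (Rk := 0) (εk := 0) (fun x => by simp) (by rw [zero_mul]; positivity) x
  exact h

end Literature.MathematicalPhysics.QuantumFieldTheory.Balaban1983to89.B16Ineq17BoxTorus

end
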